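import Literature.MathematicalPhysics.QuantumFieldTheory.Balaban1983to89.T3LoopLawNondegenerate
import Literature.MathematicalPhysics.QuantumFieldTheory.Balaban1983to89.CentreTwistBlockAvg
import HarnessLib

/-!
# `Balaban1983to89.T3CentreSymmetry` — CENTRE SYMMETRY OF THE CONTINUUM-LIMIT POINTS of SU(2) Yang–Mills on a three-torus: every
subsequential limit functional of the d = 3 Wilson scheme annihilates every string of unit-scale averaged loop variables with ODD total
winding number; the Polyakov loop has zero expectation in every limit point; and the non-triviality binder (NT3) for a Polyakov label
is EXACTLY a bound on the doubly-wound loop (bookkeeping; nothing open is asserted)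

CITATION HEADER (lean-in-tree rule).  Cell `ym3-torus` (HUMAN RULING D-0037, rung R3), seat `ym3-torus-p2` (IR-side node; HOME/IR-NODE.md §3–4: for bounded
loop variables «non-Gaussian» ≡ non-degenerate, and the located open content is a variance lower bound — this file pins the first moment).
Sources: G. 't Hooft, Nucl. Phys. B **153** (1979) 141 [tHooft1979Flux] §2 (the electric `Z_N` centre symmetry of the pure gauge theory in a
periodic box: twisting the links through a hyperplane by a centre element preserves the action); L. McLerran, B. Svetitsky, Phys. Lett. B **98**
(1981) 195 [McLerranSvetitsky1981] (the Wilson/Polyakov line closed by periodicity is odd under the `Z₂` twist, so its expectation vanishes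
whenever the symmetry is realised — as it is, exactly, in every finite periodic volume); T. Bałaban, CMP **109** (1987) [Balaban1987RG1] (0.4),
(2.17) (block averaging and its symmetries; tree `CentreTwistBlockAvg.exists_iter_blockAvg_ctwist`); S. Chatterjee in Friz et al. (eds.) 2019
[Chatterjee2019YMProbabilists] §6 (book p. 19) («nontrivial behavior» of Wilson loop variables in the limit is the open point).

WHAT IS PROVED (all [folklore]-grade bookkeeping over `CentreTwist`, `CentreTwistBlockAvg`, `T3CovarianceRP`, `T3LoopLawNondegenerate`):
§1 winding numbers of labels (`ULoop3.wind`), the doubled label `C·C` and the straight Polyakov label (winding `1`); §2 for ANY compact `G` with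
a central involution `z` that flips the normalised trace (`reTr (z g) = −reTr g`): the `K`-th joint expectation of a string `Cs` equals
`(−1)^{Σ wind}` times itself (`expectAt_eq_negOnePow_mul`: the top-lattice twist is the `K`-fold average of a fine twist, an exact symmetry of
the Wilson theory), hence VANISHES for odd total winding at every `K` (`expectAt_eq_zero_of_odd`) and so does EVERY LIMIT FUNCTIONAL
(`limit_eq_zero_of_odd`); §3 `SU(2)`, `z = −1`: no hypothesis left (`expectAt_eq_zero_of_odd_SU2`, `limit_polyakov_eq_zero`); §4 the `SU(2)`
identity `Re tr(g²)/2 = 2(Re tr g/2)² − 1` gives `⟨W̄_C²⟩_K = (1 + ⟨W̄_{C·C}⟩_K)/2` (`expectAt_pair_eq`), so for an odd-winding label the lattice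
variance is `(1 + ⟨W̄_{C·C}⟩_K)/2` and **(NT3) `UniformVariance S C c ⇔ ∀ᶠ K, 2c − 1 ≤ ⟨W̄_{C·C}⟩_K`** (`uniformVariance_iff_double`): the
non-degeneracy of the Polyakov loop law in the continuum limit is EXACTLY the statement that the doubly-wound Polyakov loop stays away from
`−1` — a located, one-observable form of the open content; §5 LAW FORM: every weak limit of the loop laws is invariant under the centre
sign-flip of the cube (`limitLoopLaw_centreFlip_invariant`: the would-be continuum loop law carries the unbroken `Z₂³` electric centre symmetry).
NOT a proof of non-triviality; NOT deconfinement physics (finite volume).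
-/

noncomputable section

open Filter Topology MeasureTheory
open Literature.MathematicalPhysics.QuantumFieldTheory.Balaban1983to89
open Literature.MathematicalPhysics.QuantumFieldTheory.Balaban1983to89.Missing
open Literature.MathematicalPhysics.QuantumFieldTheory.Balaban1983to89.T4Continuum
open Literature.MathematicalPhysics.QuantumFieldTheory

namespace Literature.MathematicalPhysics.QuantumFieldTheory.Balaban1983to89

namespace T3ContinuumYM3Torus

universe u

/-! ## 1. Winding numbers of labels; the doubled label; the Polyakov label -/

namespace T3Family

/-- The unit torus has `2L^m` sites per direction at the top of EVERY approximation (private twin of the node's lemma; gate dedup). [cite: Balaban1985UV3, (1)-(3) p.256] -/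
private theorem sitesPerDir_top'' (F : T3Family) (K : ℕ) : (F.P K).sitesPerDir K = 2 * F.L ^ F.m := by
  simp [Params.sitesPerDir]

end T3Family

namespace ULoop3

variable {F : T3Family}

/-- THE WINDING NUMBER of a label around the `μ`-period of the unit torus: net `μ`-displacement of its word divided by the period
`2L^m` (exact division, the word being closed modulo the period). [cite: McLerranSvetitsky1981] -/
def wind (μ : Fin 3) (C : ULoop3 F) : ℤ := netDisp C.1.word μ / ((2 * F.L ^ F.m : ℕ) : ℤ)

/-- `netDisp_μ = wind_μ · (period)`, the period read at the top level of any approximation. [cite: McLerranSvetitsky1981] -/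
theorem netDisp_eq_wind_mul (μ : Fin 3) (C : ULoop3 F) (K : ℕ) :
    netDisp C.1.word μ = C.wind μ * ((F.P K).sitesPerDir K : ℤ) := by
  have h := C.2 μ
  rw [ZMod.intCast_zmod_eq_zero_iff_dvd, T3Family.sitesPerDir_top''] at h
  rw [wind, T3Family.sitesPerDir_top'', Int.ediv_mul_cancel h]

/-- THE DOUBLED LABEL `C·C`: the word traversed twice (for `SU(2)`, `W̄_{C·C} = 2W̄_C² − 1`). [folklore] -/
def double (C : ULoop3 F) : ULoop3 F :=
  ⟨⟨C.1.base, C.1.word ++ C.1.word⟩, fun ν => by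
    have h := C.2 ν
    show ((netDisp (C.1.word ++ C.1.word) ν : ℤ) : ZMod ((F.P 0).sitesPerDir 0)) = 0
    rw [T4ReflectionCone.netDisp_append, Int.cast_add, h, add_zero]⟩

/-- THE STRAIGHT POLYAKOV LABEL through `x` in direction `μ`: `2L^m` letters `+e_μ` (closed by periodicity, winding once). [cite: McLerranSvetitsky1981] -/
def polyakov (μ : Fin 3) (x : F.USite) : ULoop3 F :=
  ⟨⟨x, List.replicate (2 * F.L ^ F.m) (μ, true)⟩, fun ν => by
    show ((netDisp (List.replicate (2 * F.L ^ F.m) (μ, true)) ν : ℤ) : ZMod ((F.P 0).sitesPerDir 0)) = 0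
    rw [T4ReflectionCone.netDisp_replicate]
    by_cases h : μ = ν
    · simp only [h, if_true, mul_one, Int.cast_natCast]
      rw [ZMod.natCast_eq_zero_iff, T3Family.sitesPerDir_top'']
    · simp [h]⟩

/-- The Polyakov label winds once around its direction. [cite: McLerranSvetitsky1981] -/
theorem wind_polyakov (μ : Fin 3) (x : F.USite) : (polyakov μ x).wind μ = 1 := by
  have hN : ((2 * F.L ^ F.m : ℕ) : ℤ) ≠ 0 := by
    have := F.hL.2; positivity
  rw [wind]
  show netDisp (List.replicate (2 * F.L ^ F.m) (μ, true)) μ / ((2 * F.L ^ F.m : ℕ) : ℤ) = 1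
  rw [T4ReflectionCone.netDisp_replicate]
  simp only [if_true, mul_one]
  exact Int.ediv_self hN

end ULoop3

/-! ## 2. The sign law and the vanishing of odd-winding strings — any `G` with a trace-flipping central involution -/

section Sign

variable {G : Type u} [GaugeGroup G] (F : T3Family) (ℰ : LoopAverage G) {z : G}

/-- `z^w = 1` or `z` according to the parity of `w`, for an involution `z`. [folklore] -/
private theorem zpow_of_mul_self {z : G} (hz2 : z * z = 1) (w : ℤ) : z ^ w = if Even w then 1 else z := by
  have hsq : z ^ (2 : ℤ) = 1 := by rw [show (2 : ℤ) = 1 + 1 by norm_num, zpow_add, zpow_one, hz2]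
  rcases Int.even_or_odd' w with ⟨k, rfl | rfl⟩
  · rw [if_pos ⟨k, two_mul k⟩, zpow_mul, hsq, one_zpow]
  · have hodd : ¬ Even (2 * k + 1) := Int.not_even_iff_odd.mpr ⟨k, rfl⟩
    rw [if_neg hodd, zpow_add, zpow_one, zpow_mul, hsq, one_zpow, one_mul]

/-- The normalised trace of `z^w g` is `(−1)^w` times that of `g` when `z` is a trace-flipping involution. [folklore] -/
private theorem reTr_zpow_mul {z : G} (hz2 : z * z = 1) (hre : ∀ g : G, reTr (z * g) = -reTr g) (w : ℤ) (g : G) :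
    reTr (z ^ w * g) = (-1 : ℝ) ^ w * reTr g := by
  rw [zpow_of_mul_self hz2]
  by_cases hw : Even w
  · rw [if_pos hw, one_mul, hw.neg_one_zpow, one_mul]
  · rw [if_neg hw, hre, (Int.not_even_iff_odd.mp hw).neg_one_zpow, neg_one_mul]

/-- **THE SIGN LAW FOR UNIT-SCALE AVERAGED LOOP VARIABLES**: twisting the unit-lattice (`K`-fold averaged) field along a slice multiplies
the loop variable of the label `C` by `(−1)^{wind_μ C}` (winding law `CentreTwist.holAt_ctwist_walk_of_netDisp_eq_mul`). [cite: McLerranSvetitsky1981] -/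
theorem loopAt_ctwist_atLevel (hz : ∀ g : G, z * g = g * z) (hz2 : z * z = 1) (hre : ∀ g : G, reTr (z * g) = -reTr g)
    (μ : Fin 3) (K : ℕ) (s : ZMod ((F.P K).sitesPerDir K)) (C : ULoop3 F) (V : GaugeField (F.P K) K G) :
    loopAt (V.ctwist z μ s) (C.1.atLevel K) = (-1 : ℝ) ^ C.wind μ * loopAt V (C.1.atLevel K) := by
  rw [loopAt, loopAt, UWord3.atLevel, holAt_ctwist_walk_of_netDisp_eq_mul hz μ s V _ (C.netDisp_eq_wind_mul μ K),
    reTr_zpow_mul hz2 hre]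

/-- **THE TOP TWIST IS THE IMAGE OF A FINE TWIST, on observables**: for every `K` there is a twist of the finest torus `T_ε` under which every
unit-scale averaged loop variable is multiplied by `(−1)^{wind}` (`CentreTwistBlockAvg.exists_iter_blockAvg_ctwist`). [cite: Balaban1987RG1, (2.17) p.269] -/
theorem exists_ctwist_avgObs (hz : ∀ g : G, z * g = g * z) (hz2 : z * z = 1) (hre : ∀ g : G, reTr (z * g) = -reTr g)
    (μ : Fin 3) (K : ℕ) : ∃ s₀ : ZMod ((F.P K).sitesPerDir 0), ∀ (C : ULoop3 F) (U : GaugeField (F.P K) 0 G),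
      F.avgObs ℰ K C (U.ctwist z μ s₀) = (-1 : ℝ) ^ C.wind μ * F.avgObs ℰ K C U := by
  obtain ⟨s₀, h₀⟩ := BlockAveraging.exists_iter_blockAvg_ctwist (P := F.P K) ℰ hz μ K (Nat.le_add_left K F.m) 0
  exact ⟨s₀, fun C U => by
    show loopAt (Averaging.iter (fun j => BlockAveraging.blockAvg (P := F.P K) (j := j) ℰ) K (U.ctwist z μ s₀)) (C.1.atLevel K) = _
    rw [h₀ U, loopAt_ctwist_atLevel F hz hz2 hre]
    rfl⟩

/-- Products of signed factors: `∏ (ε_C x_C) = (−1)^{Σ w_C} ∏ x_C`. [folklore] -/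
private theorem prod_map_negOnePow_mul (w : ULoop3 F → ℤ) (x : ULoop3 F → ℝ) :
    ∀ Cs : List (ULoop3 F), (Cs.map fun C => (-1 : ℝ) ^ w C * x C).prod = (-1 : ℝ) ^ (Cs.map w).sum * (Cs.map x).prod
  | [] => by simp
  | C :: Cs => by
    rw [List.map_cons, List.prod_cons, prod_map_negOnePow_mul w x Cs, List.map_cons, List.sum_cons, List.map_cons,
      List.prod_cons, zpow_add₀ (by norm_num : (-1 : ℝ) ≠ 0)]
    ring

variable [MeasurableSpace G] [HaarData G]

/-- Scalars pass through the torus expectation (junk values included). [folklore] -/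
private theorem expect_const_mul (P : Params) (β c : ℝ) (f : GaugeField P 0 G → ℝ) :
    expect P β (fun U => c * f U) = c * expect (G := G) P β f := by
  unfold expect
  rw [← mul_div_assoc]
  congr 1
  simp only [mul_assoc]
  exact integral_const_mul c _

variable [RegularGaugeGroup G]

/-- **THE SIGN IDENTITY FOR JOINT EXPECTATIONS**: `⟨∏_{C ∈ Cs} W̄_C⟩_K = (−1)^{Σ_C wind_μ C} · ⟨∏_{C ∈ Cs} W̄_C⟩_K` at every `K` and every
coupling — the fine twist is an exact symmetry of the Wilson theory (`Missing.IsExpectSymmetry.ctwist`). [cite: tHooft1979Flux, §2] -/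
theorem expectAt_eq_negOnePow_mul (hz : ∀ g : G, z * g = g * z) (hz2 : z * z = 1) (hre : ∀ g : G, reTr (z * g) = -reTr g)
    (μ : Fin 3) (γ : ℝ) (K : ℕ) (Cs : List (ULoop3 F)) :
    (F.scheme ℰ γ).expectAt K Cs = (-1 : ℝ) ^ (Cs.map (ULoop3.wind μ)).sum * (F.scheme ℰ γ).expectAt K Cs := by
  obtain ⟨s₀, h₀⟩ := exists_ctwist_avgObs F ℰ hz hz2 hre μ K
  have hsym := Missing.IsExpectSymmetry.ctwist (G := G) hz (P := F.P K) (β := (F.scheme ℰ γ).β K) μ s₀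
    (fun U => (Cs.map fun C => F.avgObs ℰ K C U).prod)
  have hprod : ∀ U : GaugeField (F.P K) 0 G, (Cs.map fun C => F.avgObs ℰ K C (U.ctwist z μ s₀)).prod =
      (-1 : ℝ) ^ (Cs.map (ULoop3.wind μ)).sum * (Cs.map fun C => F.avgObs ℰ K C U).prod := fun U => by
    simp_rw [h₀]
    exact prod_map_negOnePow_mul (F := F) (fun C : ULoop3 F => C.wind μ) (fun C : ULoop3 F => F.avgObs ℰ K C U) Cs
  simp_rw [hprod, expect_const_mul] at hsym
  exact hsym.symm

/-- **ODD-WINDING STRINGS HAVE ZERO EXPECTATION AT EVERY `K`** (in some direction `μ` the windings of the labels of `Cs` add up to an odd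
number). [cite: McLerranSvetitsky1981] -/
theorem expectAt_eq_zero_of_odd (hz : ∀ g : G, z * g = g * z) (hz2 : z * z = 1) (hre : ∀ g : G, reTr (z * g) = -reTr g)
    {μ : Fin 3} (γ : ℝ) (K : ℕ) {Cs : List (ULoop3 F)} (hodd : Odd (Cs.map (ULoop3.wind μ)).sum) :
    (F.scheme ℰ γ).expectAt K Cs = 0 := by
  have h := expectAt_eq_negOnePow_mul F ℰ hz hz2 hre μ γ K Cs
  rw [hodd.neg_one_zpow, neg_one_mul] at h
  linarith

/-- **… HENCE ZERO VALUE UNDER EVERY SUBSEQUENTIAL LIMIT FUNCTIONAL** (centre symmetry of the continuum-limit points). [cite: McLerranSvetitsky1981] -/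
theorem limit_eq_zero_of_odd (hz : ∀ g : G, z * g = g * z) (hz2 : z * z = 1) (hre : ∀ g : G, reTr (z * g) = -reTr g)
    {μ : Fin 3} (γ : ℝ) {φ : ℕ → ℕ} {E : List (ULoop3 F) → ℝ} (hE : IsLimitFunctional (fun K => (F.scheme ℰ γ).expectAt (φ K)) E)
    {Cs : List (ULoop3 F)} (hodd : Odd (Cs.map (ULoop3.wind μ)).sum) : E Cs = 0 := by
  have h0 : (fun K => (F.scheme ℰ γ).expectAt (φ K) Cs) = fun _ => 0 :=
    funext fun K => expectAt_eq_zero_of_odd F ℰ hz hz2 hre γ (φ K) hodd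
  have h := hE Cs
  rw [h0] at h
  exact tendsto_nhds_unique h tendsto_const_nhds

end Sign

/-! ## 3. `SU(2)`: the centre element `−1` — no hypothesis left -/

section SU2

open Literature.MathematicalPhysics.QuantumLattice

/-- The non-trivial centre element `−1 ∈ SU(2)`. [cite: tHooft1979Flux, §2] -/
def negOne₂ : Matrix.specialUnitaryGroup (Fin 2) ℂ :=
  ⟨-1, by
    rw [Matrix.mem_specialUnitaryGroup_iff]
    refine ⟨?_, by simp [Matrix.det_neg, Matrix.det_one]⟩
    rw [Matrix.mem_unitaryGroup_iff]
    simp⟩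

/-- `−1` is central in `SU(2)` (the centre is `{±1} = Z₂`). [cite: tHooft1979Flux, §2] -/
theorem negOne₂_comm (g : Matrix.specialUnitaryGroup (Fin 2) ℂ) : negOne₂ * g = g * negOne₂ :=
  Subtype.ext (by simp [negOne₂])

/-- `(−1)² = 1`: the centre element is an involution (`Z₂`). [cite: tHooft1979Flux, §2] -/
theorem negOne₂_mul_self : negOne₂ * negOne₂ = 1 :=
  Subtype.ext (by simp [negOne₂])

/-- `Re tr(−g)/2 = −Re tr(g)/2`: the fundamental loop variable is odd under the centre (the Polyakov line changes sign). [cite: McLerranSvetitsky1981] -/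
theorem reTr_negOne₂_mul (g : Matrix.specialUnitaryGroup (Fin 2) ℂ) : reTr (negOne₂ * g) = -reTr g := by
  show UnitaryModel.nReTr (fundamentalRep (Fin 2) (negOne₂ * g)) = -UnitaryModel.nReTr (fundamentalRep (Fin 2) g)
  simp [UnitaryModel.nReTr, fundamentalRep, negOne₂, neg_div]

variable (F : T3Family) (ℰ : LoopAverage (Matrix.specialUnitaryGroup (Fin 2) ℂ)) (γ : ℝ)

/-- **`SU(2)` YM₃ ON A THREE-TORUS: ODD-WINDING STRINGS OF AVERAGED LOOP VARIABLES HAVE ZERO EXPECTATION at every lattice spacing and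
every coupling** (every small-loop average `ℰ`). [cite: McLerranSvetitsky1981] -/
theorem expectAt_eq_zero_of_odd_SU2 {μ : Fin 3} (K : ℕ) {Cs : List (ULoop3 F)} (hodd : Odd (Cs.map (ULoop3.wind μ)).sum) :
    (F.scheme ℰ γ).expectAt K Cs = 0 :=
  expectAt_eq_zero_of_odd F ℰ negOne₂_comm negOne₂_mul_self reTr_negOne₂_mul γ K hodd

/-- **CENTRE SYMMETRY OF THE CONTINUUM-LIMIT POINTS (`SU(2)`)**: every subsequential limit functional of the d = 3 Wilson scheme vanishes
on every odd-winding string. [cite: tHooft1979Flux, §2] -/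
theorem limit_eq_zero_of_odd_SU2 {μ : Fin 3} {φ : ℕ → ℕ} {E : List (ULoop3 F) → ℝ}
    (hE : IsLimitFunctional (fun K => (F.scheme ℰ γ).expectAt (φ K)) E) {Cs : List (ULoop3 F)}
    (hodd : Odd (Cs.map (ULoop3.wind μ)).sum) : E Cs = 0 :=
  limit_eq_zero_of_odd F ℰ negOne₂_comm negOne₂_mul_self reTr_negOne₂_mul γ hE hodd

/-- **THE POLYAKOV LOOP HAS ZERO EXPECTATION IN EVERY LIMIT POINT** (and at every `K`). [cite: McLerranSvetitsky1981] -/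
theorem limit_polyakov_eq_zero (μ : Fin 3) (x : F.USite) {φ : ℕ → ℕ} {E : List (ULoop3 F) → ℝ}
    (hE : IsLimitFunctional (fun K => (F.scheme ℰ γ).expectAt (φ K)) E) : E [ULoop3.polyakov μ x] = 0 :=
  limit_eq_zero_of_odd_SU2 F ℰ γ hE (μ := μ) (by simp [ULoop3.wind_polyakov])

/-! ## 4. `SU(2)`: the doubly-wound loop and the exact form of (NT3) for odd-winding labels -/

/-- The trace of an `SU(2)` matrix is real (`gᴴ = adj g` for `det g = 1`; private copy of a standard computation). [folklore] -/
private theorem trace_im_eq_zero_SU2 (g : Matrix.specialUnitaryGroup (Fin 2) ℂ) :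
    ((g : Matrix (Fin 2) (Fin 2) ℂ).trace).im = 0 := by
  obtain ⟨hU, hdet⟩ := Matrix.mem_specialUnitaryGroup_iff.mp g.2
  set A : Matrix (Fin 2) (Fin 2) ℂ := (g : Matrix (Fin 2) (Fin 2) ℂ)
  have h1 : star A * A = 1 := Matrix.mem_unitaryGroup_iff'.mp hU
  have h2 : A.adjugate * A = 1 := by rw [Matrix.adjugate_mul, hdet, one_smul]
  have h3 : star A = A.adjugate := by rw [← Matrix.inv_eq_left_inv h1, Matrix.inv_eq_left_inv h2]
  have h4 : star (A 0 0) = A 1 1 := by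
    have := congrFun (congrFun h3 0) 0
    rw [Matrix.adjugate_fin_two] at this
    simpa [Matrix.star_apply] using this
  rw [Matrix.trace_fin_two, ← h4, Complex.star_def, Complex.add_im, Complex.conj_im]
  ring

/-- `tr(A²) = (tr A)² − 2 det A` for `2 × 2` matrices. [folklore] -/
private theorem trace_mul_self_fin_two (A : Matrix (Fin 2) (Fin 2) ℂ) : (A * A).trace = A.trace ^ 2 - 2 * A.det := by
  rw [Matrix.trace_fin_two, Matrix.trace_fin_two, Matrix.det_fin_two]
  simp only [Matrix.mul_apply, Fin.sum_univ_two]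
  ring

/-- **`SU(2)`: `Re tr(g²)/2 = 2 (Re tr g/2)² − 1`** (`cos 2θ = 2cos²θ − 1`). [folklore] -/
private theorem reTr_mul_self_SU2 (g : Matrix.specialUnitaryGroup (Fin 2) ℂ) : reTr (g * g) = 2 * reTr g ^ 2 - 1 := by
  have hdet : (g : Matrix (Fin 2) (Fin 2) ℂ).det = 1 := (Matrix.mem_specialUnitaryGroup_iff.mp g.2).2
  have him := trace_im_eq_zero_SU2 g
  show UnitaryModel.nReTr (fundamentalRep (Fin 2) (g * g)) = 2 * UnitaryModel.nReTr (fundamentalRep (Fin 2) g) ^ 2 - 1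
  simp only [UnitaryModel.nReTr, fundamentalRep, Submonoid.coe_subtype, Submonoid.coe_mul, Fintype.card_fin]
  rw [trace_mul_self_fin_two, hdet, mul_one]
  have h2 : ((2 : ℂ)).re = 2 := by norm_num
  simp only [Complex.sub_re, pow_two, Complex.mul_re, him, mul_zero, sub_zero, h2]
  push_cast
  ring

variable {ℰ}

/-- **`W̄_{C·C} = 2 W̄_C² − 1` for `SU(2)`** (the doubled label's representative is the representative walked twice, closed at the base;
normalised trace (0.2) of the square of the holonomy). [cite: Balaban1987RG1, (0.2)/(0.4) p.252] -/
theorem avgObs_double (K : ℕ) (C : ULoop3 F) (U : GaugeField (F.P K) 0 (Matrix.specialUnitaryGroup (Fin 2) ℂ)) :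
    F.avgObs ℰ K C.double U = 2 * F.avgObs ℰ K C U ^ 2 - 1 := by
  obtain ⟨Cw, hC⟩ := C
  set V := Averaging.iter (fun j => BlockAveraging.blockAvg (P := F.P K) (j := j) ℰ) K U with hV
  have hw := walk_append (P := F.P K) (F.toLevel K Cw.base) Cw.word Cw.word
  rw [hC.walkEnd_atLevel K] at hw
  have h1 : loopAt V (walk (F.toLevel K Cw.base) (Cw.word ++ Cw.word)) =
      loopAt V (walk (F.toLevel K Cw.base) Cw.word ++ walk (F.toLevel K Cw.base) Cw.word) := congrArg (loopAt V) hw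
  show loopAt V (walk (F.toLevel K Cw.base) (Cw.word ++ Cw.word)) = 2 * loopAt V (walk (F.toLevel K Cw.base) Cw.word) ^ 2 - 1
  rw [h1, loopAt, loopAt, holAt_append, reTr_mul_self_SU2]

variable {γ}

/-- **`⟨W̄_C · W̄_C⟩_K = (1 + ⟨W̄_{C·C}⟩_K)/2`** for `SU(2)`, measurable `ℰ`, `γ ≥ 0` (expectation of the identity `W̄_{C·C} = 2W̄_C² − 1`
under the `K`-th Wilson Gibbs measure). [cite: Balaban1987RG1, (0.2)/(0.4) p.252] -/
theorem expectAt_pair_eq (hE : ℰ.MeasurableE) (hγ : 0 ≤ γ) (K : ℕ) (C : ULoop3 F) :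
    (F.scheme ℰ γ).expectAt K [C, C] = (1 + (F.scheme ℰ γ).expectAt K [C.double]) / 2 := by
  have hβ := F.scheme_β_nonneg ℰ hγ
  set μK : Measure (GaugeField (F.P K) 0 (Matrix.specialUnitaryGroup (Fin 2) ℂ)) :=
    T4GenFunBounds.gibbsMeasure (F.P K) ((F.scheme ℰ γ).β K) with hμK
  haveI : IsProbabilityMeasure μK :=
    T4GenFunBounds.isProbabilityMeasure_gibbsMeasure (G := Matrix.specialUnitaryGroup (Fin 2) ℂ) (F.P K) (hβ K)
  have hm : Measurable (F.avgObs ℰ K C) := F.measurable_avgObs (F.avgMeasurable_of_measurableE ℰ hE) K C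
  have hint : Integrable (fun U => F.avgObs ℰ K C U ^ 2) μK :=
    (integrable_const (1 : ℝ)).mono' (hm.pow_const 2).aestronglyMeasurable (ae_of_all _ fun U => by
      rw [Real.norm_eq_abs, abs_pow, pow_le_one_iff_of_nonneg (abs_nonneg _) two_ne_zero]
      exact F.abs_avgObs_le_one ℰ K C U)
  have hobs : ∀ (C' : ULoop3 F) (U : GaugeField (F.P K) 0 (Matrix.specialUnitaryGroup (Fin 2) ℂ)),
      (F.scheme ℰ γ).obs K C' U = F.avgObs ℰ K C' U := fun _ _ => rfl
  have e1 : (F.scheme ℰ γ).expectAt K [C, C] = ∫ U, F.avgObs ℰ K C U ^ 2 ∂μK := by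
    rw [T4GenFunBounds.expectAt_eq_integral_gibbs _ hβ K]
    change ∫ U, T4GenFunBounds.prodObs (F.scheme ℰ γ) K [C, C] U ∂μK = _
    refine integral_congr_ae (ae_of_all _ fun U => ?_)
    simp only [T4GenFunBounds.prodObs, List.map_cons, List.map_nil, List.prod_cons, List.prod_nil, mul_one, hobs, pow_two]
  have e2 : (F.scheme ℰ γ).expectAt K [C.double] = 2 * ∫ U, F.avgObs ℰ K C U ^ 2 ∂μK - 1 := by
    rw [T4GenFunBounds.expectAt_eq_integral_gibbs _ hβ K]
    change ∫ U, T4GenFunBounds.prodObs (F.scheme ℰ γ) K [C.double] U ∂μK = _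
    have h1 : ∫ U, T4GenFunBounds.prodObs (F.scheme ℰ γ) K [C.double] U ∂μK = ∫ U, (2 * F.avgObs ℰ K C U ^ 2 - 1) ∂μK :=
      integral_congr_ae (ae_of_all _ fun U => by
        simp only [T4GenFunBounds.prodObs, List.map_cons, List.map_nil, List.prod_cons, List.prod_nil, mul_one, hobs,
          avgObs_double])
    rw [h1, integral_sub (hint.const_mul 2) (integrable_const 1), integral_const_mul, integral_const, smul_eq_mul, mul_one,
      probReal_univ]
  rw [e1, e2]
  ring

/-- **(NT3) FOR AN ODD-WINDING LABEL IS A BOUND ON THE DOUBLY-WOUND LOOP**: since `⟨W̄_C⟩_K = 0` (centre symmetry) and `⟨W̄_C²⟩_K =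
(1 + ⟨W̄_{C·C}⟩_K)/2`, the uniform variance lower bound `c` holds iff eventually `⟨W̄_{C·C}⟩_K ≥ 2c − 1`: the continuum Polyakov-loop law is
non-degenerate iff the doubly-wound Polyakov loop stays away from `−1`.  The right-hand side is OPEN and NOT in print. [cite: Chatterjee2019YMProbabilists, §6 p.19] -/
theorem uniformVariance_iff_double (hE : ℰ.MeasurableE) (hγ : 0 ≤ γ) {μ : Fin 3} {C : ULoop3 F} (hodd : Odd (C.wind μ))
    {c : ℝ} (hc : 0 < c) :
    UniformVariance (F.scheme ℰ γ) C c ↔ ∀ᶠ K in atTop, 2 * c - 1 ≤ (F.scheme ℰ γ).expectAt K [C.double] := by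
  have h1 : ∀ K, (F.scheme ℰ γ).expectAt K [C] = 0 := fun K =>
    expectAt_eq_zero_of_odd_SU2 F ℰ γ K (μ := μ) (by simpa using hodd)
  have h2 : ∀ K, (F.scheme ℰ γ).expectAt K [C, C] = (1 + (F.scheme ℰ γ).expectAt K [C.double]) / 2 :=
    fun K => expectAt_pair_eq F hE hγ K C
  simp only [UniformVariance, hc, true_and, h1, h2]
  constructor <;> intro h <;> filter_upwards [h] with K hK <;> linarith

/-- In particular for the straight Polyakov label: **non-degeneracy of the continuum Polyakov-loop law ⇔ the doubly-wound Polyakov loop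
stays away from `−1` uniformly in the lattice spacing.** [cite: Chatterjee2019YMProbabilists, §6 p.19] -/
theorem uniformVariance_polyakov_iff (hE : ℰ.MeasurableE) (hγ : 0 ≤ γ) (μ : Fin 3) (x : F.USite) {c : ℝ} (hc : 0 < c) :
    UniformVariance (F.scheme ℰ γ) (ULoop3.polyakov μ x) c ↔
      ∀ᶠ K in atTop, 2 * c - 1 ≤ (F.scheme ℰ γ).expectAt K [(ULoop3.polyakov μ x).double] :=
  uniformVariance_iff_double F hE hγ (μ := μ) (by rw [ULoop3.wind_polyakov]; exact odd_one) hc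

end SU2


/-! ## 5. Law form: every weak limit of the loop laws is invariant under the centre sign-flip of the loop cube (`SU(2)`) -/

section LawFlip

variable {F : T3Family}

/-- Negation on `[-1,1]`. [folklore] -/
def negIcc (t : Set.Icc (-1 : ℝ) 1) : Set.Icc (-1 : ℝ) 1 :=
  ⟨-t.1, by obtain ⟨h1, h2⟩ := t.2; exact ⟨by linarith, by linarith⟩⟩

/-- **THE CENTRE SIGN-FLIP OF THE LOOP CUBE** in direction `μ`: the coordinates of odd-winding labels are negated (the action of the
`Z₂` centre twist on the vector of unit-scale loop variables, `loopAt_ctwist_atLevel`). [cite: tHooft1979Flux, §2] -/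
def centreFlip (μ : Fin 3) (x : T4LimitLaw.Cube (ULoop3 F)) : T4LimitLaw.Cube (ULoop3 F) :=
  fun C => if Even (C.wind μ) then x C else negIcc (x C)

/-- The sign-flip is measurable (coordinatewise continuous). [folklore] -/
private theorem measurable_centreFlip (μ : Fin 3) : Measurable (centreFlip (F := F) μ) := by
  refine measurable_pi_iff.mpr fun C => ?_
  by_cases h : Even (C.wind μ)
  · simp only [centreFlip, h, if_true]
    exact measurable_pi_apply C
  · simp only [centreFlip, h, if_false]
    exact (continuous_subtype_val.neg.subtype_mk _).measurable.comp (measurable_pi_apply C)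

/-- The flipped coordinate is `(−1)^{wind}` times the coordinate. [folklore] -/
private theorem coe_centreFlip_apply (μ : Fin 3) (x : T4LimitLaw.Cube (ULoop3 F)) (C : ULoop3 F) :
    ((centreFlip μ x C : Set.Icc (-1 : ℝ) 1) : ℝ) = (-1 : ℝ) ^ C.wind μ * (x C : ℝ) := by
  by_cases h : Even (C.wind μ)
  · simp only [centreFlip, h, if_true, h.neg_one_zpow, one_mul]
  · simp only [centreFlip, h, if_false, negIcc, (Int.not_even_iff_odd.mp h).neg_one_zpow, neg_one_mul]

/-- Monomials transform by the total sign: `∏_{C∈Cs} (flip x)_C = (−1)^{Σ wind} ∏_{C∈Cs} x_C`. [folklore] -/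
private theorem monomial_centreFlip (μ : Fin 3) (Cs : List (ULoop3 F)) (x : T4LimitLaw.Cube (ULoop3 F)) :
    T4LimitLaw.monomial Cs (centreFlip μ x) = (-1 : ℝ) ^ (Cs.map (ULoop3.wind μ)).sum * T4LimitLaw.monomial Cs x := by
  simp only [T4LimitLaw.monomial, coe_centreFlip_apply]
  exact prod_map_negOnePow_mul (F := F) (fun C : ULoop3 F => C.wind μ) (fun C : ULoop3 F => (x C : ℝ)) Cs

variable (F) (ℰ : LoopAverage (Matrix.specialUnitaryGroup (Fin 2) ℂ)) {γ : ℝ}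

/-- **LAW FORM OF THE CENTRE SYMMETRY (`SU(2)`)**: every weak limit `ν` of the loop laws along any sequence of steps is invariant under the
centre sign-flip of the cube, `ν ∘ (centreFlip μ)⁻¹ = ν`, for each of the three directions — the would-be continuum loop law of YM₃ on `T³`
carries the unbroken `Z₂³` electric centre symmetry. [cite: tHooft1979Flux, §2] -/
theorem limitLoopLaw_centreFlip_invariant (hℰ : F.AvgMeasurable ℰ) (hγ : 0 ≤ γ) (μ : Fin 3) {κ : ℕ → ℕ}
    {ν : ProbabilityMeasure (T4LimitLaw.Cube (ULoop3 F))} (hν : Tendsto (fun n => loopLaw F hℰ hγ (κ n)) atTop (𝓝 ν)) :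
    (ν : Measure (T4LimitLaw.Cube (ULoop3 F))).map (centreFlip μ) = ν := by
  have hE : IsLimitFunctional (fun n => (F.scheme ℰ γ).expectAt (κ n))
      fun Cs => ∫ x, T4LimitLaw.monomial Cs x ∂(ν : Measure (T4LimitLaw.Cube (ULoop3 F))) :=
    T4LimitLaw.isLimitFunctional_of_tendsto_law (F.scheme ℰ γ) (F.scheme_β_nonneg ℰ hγ)
      (fun K C => F.measurable_avgObs hℰ K C) (fun K C U => F.abs_avgObs_le_one ℰ K C U) hν
  haveI : IsProbabilityMeasure ((ν : Measure (T4LimitLaw.Cube (ULoop3 F))).map (centreFlip μ)) :=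
    Measure.isProbabilityMeasure_map (measurable_centreFlip μ).aemeasurable
  refine T4LimitLaw.measure_eq_of_forall_integral_prod_eq (e := T4LimitLaw.coord) T4LimitLaw.coord_separatesPoints fun Cs => ?_
  simp only [T4LimitLaw.prod_coord_apply]
  rw [integral_map (measurable_centreFlip μ).aemeasurable (T4LimitLaw.measurable_monomial Cs).aestronglyMeasurable]
  simp_rw [monomial_centreFlip]
  rw [integral_const_mul]
  -- the limit functional is fixed by the sign: pass `⟨∏⟩_K = (−1)^Σ ⟨∏⟩_K` to the limit
  set ε : ℝ := (-1 : ℝ) ^ (Cs.map (ULoop3.wind μ)).sum with hε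
  have h1 : Tendsto (fun n => (F.scheme ℰ γ).expectAt (κ n) Cs) atTop
      (𝓝 (ε * ∫ x, T4LimitLaw.monomial Cs x ∂(ν : Measure (T4LimitLaw.Cube (ULoop3 F))))) := by
    have h := (hE Cs).const_mul ε
    refine h.congr fun n => ?_
    exact (expectAt_eq_negOnePow_mul F ℰ negOne₂_comm negOne₂_mul_self reTr_negOne₂_mul μ γ (κ n) Cs).symm
  exact (tendsto_nhds_unique h1 (hE Cs)).symm ▸ rfl

end LawFlip

end T3ContinuumYM3Torus

end Literature.MathematicalPhysics.QuantumFieldTheory.Balaban1983to89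

end
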